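import Mathlib
import Literature.AlgebraicGeometry.Resolution.CobordantChartCoefficients
import Summits.ResolutionOfSingularities.ResolutionOfSingularities.Theorems.WeightedInvariantLocalWeightedDropSliceOrder
import Summits.ResolutionOfSingularities.ResolutionOfSingularities.Theorems.WeightedInvariantLocalWeightedDropHornedRankEquiv

/-!
# `WeightedInvariant.LocalWeightedDrop`, line `hasse-ridge-face-selection`: apex-free order drop

Crux item stmt-ResolutionOfSingularities-8899 (route `ResolutionOfSingularities/WeightedInvariant`),
skeleton v7 of the line `hasse-ridge-face-selection`, stub `stub_apexFreeOrderDrop`, PROVED here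
(statement verbatim from the ledger registration).

**Statement (char-free bookkeeping of ONE point blow-up).**  Let `F ∈ k[[x₁, …, xₙ]]` have order `d`,
let `c : Fin n → k` be an exceptional point of the blow-up of the origin (the cobordant chart with all
weights `1`, `chart 1 c : xᵢ ↦ s (cᵢ + yᵢ)`), and let `F(s(c+y)) = sᵃ · G` with `s ∤ G` be the
`s`-saturated factorisation.  If for some slot `i` with `cᵢ ≠ 0` the tame slice
`S := G|_{yᵢ = 0}` (an `n`-variable germ in `s` and the `yⱼ`, `j ≠ i`) still has order `≥ d`, then
`c` is in the APEX of the tangent cone: `in_d F (v + c) = in_d F (v)` for every `v`, where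
`in_d F (v) = CobordantChart.initEval 1 v d F = ∑_{|e| = d} F_e v^e`.

**Proof.**  (1) `ord S ≥ d ⇒ ord G ≥ d`: by the landed tame slice (`tameSlice`, weight `1` is never
divisible by `p`) `G = u · Φ(cyl S)` with `u` a unit and `Φ` a substitution without constant terms;
substitutions without constant terms and unit factors do not lower the order
(`MvPowerSeries.le_order_subst`, `MvPowerSeries.le_order_mul`).  (2) `ord G ≥ d ⇒ ord G(0,·) ≥ d` for
the `s⁰`-slice `G(0,·) = (β ↦ coeff (cons 0 β) G)` (`stub_sliceOrder`).  (3) `a = d`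
(`CobordantChart.eq_weightedOrder_of_factor`), and by `CobordantChart.coeff_cons_of_eq_X_pow_mul` and the
coefficient formula `CobordantChart.coeff_subst_chart`,
`coeff β G(0,·) = ∑_{|e| = d} F_e ∏ᵢ C(eᵢ, βᵢ) cᵢ^{eᵢ - βᵢ}`, which is the `y^β`-coefficient of the
TRANSLATE `in_d F (c + y)` (`CobordantChart.coeff_prod_C_add_X_pow`).  (4) So the translate, a polynomial
of degree `≤ d`, has no monomials of degree `< d` (`MvPowerSeries.coeff_of_lt_order`), and its degree-`d`
part is `in_d F` itself (for `|e| = d ≤ |β|`, `e ≠ β`, some `eᵢ < βᵢ` kills `C(eᵢ, βᵢ)` — the computation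
of `stub_pointBlowupOrder`): `in_d F (c + y) = in_d F (y)` as polynomials.  (5) Evaluate at `y = v`.
-/

set_option linter.dupNamespace false -- mandated namespace of this single-conjunct summit

namespace Summit.ResolutionOfSingularities.ResolutionOfSingularities.Theorems

open Literature.AlgebraicGeometry.Resolution

namespace ApexFreeOrderDrop

variable {k : Type} [Field k] {n : ℕ}

/-! ### Orders under substitutions without constant terms -/

-- adapted from `Literature.AlgebraicGeometry.Resolution.FormalShear.order_le_order_subst'` (the `Fin 2` case)
/-- Substitutions by families with zero constant terms do not lower the order (any index types). -/
theorem order_le_order_subst {σ τ : Type*} [Finite σ] {a : σ → MvPowerSeries τ k}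
    (ha : ∀ s, MvPowerSeries.constantCoeff (a s) = 0) (f : MvPowerSeries σ k) :
    f.order ≤ (MvPowerSeries.subst a f).order := by
  have h1 : (1 : ℕ∞) ≤ ⨅ s, (a s).order :=
    le_iInf fun s => MvPowerSeries.one_le_order_iff_constCoeff_eq_zero.mpr (ha s)
  calc f.order = 1 * f.order := (one_mul _).symm
    _ ≤ (⨅ s, (a s).order) * f.order := mul_le_mul' h1 le_rfl
    _ ≤ _ := MvPowerSeries.le_order_subst (MvPowerSeries.hasSubst_of_constantCoeff_zero ha) f

/-! ### Exponents of degree `d` and the finitely supported sums over them -/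

/-- For the constant weights `1` the weight of an exponent is its degree. -/
theorem weight_one_eq_degree (e : Fin n →₀ ℕ) : Finsupp.weight (fun _ : Fin n => 1) e = e.degree := by
  rw [Finsupp.degree_eq_weight_one]

/-- Membership in `univ.finsuppAntidiag d` is having weight (= degree) `d`. -/
theorem mem_antidiag_iff (d : ℕ) (e : Fin n →₀ ℕ) :
    e ∈ (Finset.univ : Finset (Fin n)).finsuppAntidiag d ↔ Finsupp.weight (fun _ : Fin n => 1) e = d := by
  rw [Finset.mem_finsuppAntidiag, weight_one_eq_degree, Finsupp.degree_eq_sum]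
  simp

/-- A finitely supported sum restricted to weight `d` is the finite sum over `univ.finsuppAntidiag d`. -/
theorem finsum_ite_weight_eq (d : ℕ) (T : (Fin n →₀ ℕ) → k) :
    ∑ᶠ e : Fin n →₀ ℕ, (if Finsupp.weight (fun _ : Fin n => 1) e = d then T e else 0) =
      ∑ e ∈ (Finset.univ : Finset (Fin n)).finsuppAntidiag d, T e := by
  rw [finsum_eq_sum_of_support_subset _
    (s := (Finset.univ : Finset (Fin n)).finsuppAntidiag d) ?_]
  · exact Finset.sum_congr rfl fun e he => if_pos ((mem_antidiag_iff d e).mp he)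
  · intro e he
    rw [Finset.mem_coe, mem_antidiag_iff]
    by_contra hne
    exact (Function.mem_support.mp he) (if_neg hne)

/-- `in_d F (v)` as a finite sum: `initEval 1 v d F = ∑_{|e| = d} F_e ∏ᵢ vᵢ^{eᵢ}`. -/
theorem initEval_one_eq_sum (v : Fin n → k) (d : ℕ) (F : MvPowerSeries (Fin n) k) :
    CobordantChart.initEval (fun _ : Fin n => 1) v d F =
      ∑ e ∈ (Finset.univ : Finset (Fin n)).finsuppAntidiag d,
        MvPowerSeries.coeff e F * ∏ i, v i ^ e i := by
  rw [CobordantChart.initEval, finsum_ite_weight_eq]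

/-- The `s⁰`-slice coefficients of the `s`-saturated transform under the point blow-up:
`coeff (cons 0 β) G = ∑_{|e| = d} F_e ∏ᵢ C(eᵢ, βᵢ) cᵢ^{eᵢ - βᵢ}` when `F(s(c+y)) = s^d · G`. -/
theorem coeff_cons_zero_eq_sum {F : MvPowerSeries (Fin n) k} {c : Fin n → k} {d : ℕ}
    {G : MvPowerSeries (Fin (n + 1)) k}
    (hfac : MvPowerSeries.subst (CobordantChart.chart (fun _ : Fin n => 1) c) F =
      MvPowerSeries.X 0 ^ d * G)
    (β : Fin n →₀ ℕ) :
    MvPowerSeries.coeff (Finsupp.cons 0 β) G =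
      ∑ e ∈ (Finset.univ : Finset (Fin n)).finsuppAntidiag d,
        MvPowerSeries.coeff e F * ∏ i, (((e i).choose (β i) : k) * c i ^ (e i - β i)) := by
  rw [CobordantChart.coeff_cons_of_eq_X_pow_mul hfac, add_zero,
    CobordantChart.coeff_subst_chart _ c (fun i hi => absurd hi one_ne_zero), finsum_ite_weight_eq]

/-! ### The top-degree part of a translated form is the form -/

/-- If `|e| ≤ |β|` and `e ≠ β` then `eᵢ < βᵢ` for some `i`. -/
theorem exists_apply_lt {e β : Fin n →₀ ℕ} (hdeg : e.degree ≤ β.degree) (hne : e ≠ β) :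
    ∃ i, e i < β i := by
  by_contra hall
  push Not at hall
  apply hne
  rw [Finsupp.degree_eq_sum, Finsupp.degree_eq_sum] at hdeg
  have hsum : ∑ i, β i = ∑ i, e i := le_antisymm (Finset.sum_le_sum fun i _ => hall i) hdeg
  ext i
  exact ((Finset.sum_eq_sum_iff_of_le fun i _ => hall i).mp hsum i (Finset.mem_univ i)).symm

/-- A binomial factor `C(eᵢ, βᵢ)` with `eᵢ < βᵢ` kills the Taylor coefficient. -/
theorem prod_choose_mul_pow_eq_zero (c : Fin n → k) {e β : Fin n →₀ ℕ} (h : ∃ i, e i < β i) :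
    ∏ i, (((e i).choose (β i) : k) * c i ^ (e i - β i)) = 0 := by
  obtain ⟨i, hi⟩ := h
  exact Finset.prod_eq_zero (Finset.mem_univ i)
    (by rw [Nat.choose_eq_zero_of_lt hi, Nat.cast_zero, zero_mul])

/-- In degrees `|β| ≥ d` the Taylor coefficients of the translate `in_d F (c + y)` are those of
`in_d F` (the computation of `stub_pointBlowupOrder`). -/
theorem sum_translate_eq_of_le (F : MvPowerSeries (Fin n) k) (c : Fin n → k) {d : ℕ}
    {β : Fin n →₀ ℕ} (hd : d ≤ β.degree) :
    ∑ e ∈ (Finset.univ : Finset (Fin n)).finsuppAntidiag d,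
        MvPowerSeries.coeff e F * ∏ i, (((e i).choose (β i) : k) * c i ^ (e i - β i)) =
      if Finsupp.weight (fun _ : Fin n => 1) β = d then MvPowerSeries.coeff β F else 0 := by
  have hkill : ∀ e ∈ (Finset.univ : Finset (Fin n)).finsuppAntidiag d, e ≠ β →
      MvPowerSeries.coeff e F * ∏ i, (((e i).choose (β i) : k) * c i ^ (e i - β i)) = 0 := by
    intro e he hne
    have hdeg : e.degree ≤ β.degree := by
      rw [← weight_one_eq_degree e, (mem_antidiag_iff d e).mp he]
      exact hd
    rw [prod_choose_mul_pow_eq_zero c (exists_apply_lt hdeg hne), mul_zero]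
  split_ifs with hβ
  · rw [Finset.sum_eq_single β hkill (fun h => absurd ((mem_antidiag_iff d β).mpr hβ) h)]
    simp
  · exact Finset.sum_eq_zero fun e he => hkill e he (fun h => hβ (h ▸ (mem_antidiag_iff d e).mp he))

/-! ### The initial form and its translate as polynomials

The degree-`d` initial form is the polynomial `in_d F = ∑_{|e| = d} F_e y^e`
(`∑ e ∈ univ.finsuppAntidiag d, monomial e (coeff e F)`), its translate is
`in_d F (c + y) = ∑_{|e| = d} F_e ∏ᵢ (cᵢ + yᵢ)^{eᵢ}`; both are written out in full (no new
definitions). -/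

/-- Coefficients of the initial form `∑_{|e| = d} F_e y^e`. -/
theorem coeff_initForm (d : ℕ) (F : MvPowerSeries (Fin n) k) (β : Fin n →₀ ℕ) :
    MvPolynomial.coeff β (∑ e ∈ (Finset.univ : Finset (Fin n)).finsuppAntidiag d,
        MvPolynomial.monomial e (MvPowerSeries.coeff e F)) =
      if β ∈ (Finset.univ : Finset (Fin n)).finsuppAntidiag d then MvPowerSeries.coeff β F else 0 := by
  rw [MvPolynomial.coeff_sum]
  simp_rw [MvPolynomial.coeff_monomial]
  rw [Finset.sum_ite_eq']

/-- Taylor coefficients of the translate `∑_{|e| = d} F_e ∏ᵢ (cᵢ + yᵢ)^{eᵢ}`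
(`CobordantChart.coeff_prod_C_add_X_pow`). -/
theorem coeff_translate (c : Fin n → k) (d : ℕ) (F : MvPowerSeries (Fin n) k) (β : Fin n →₀ ℕ) :
    MvPolynomial.coeff β (∑ e ∈ (Finset.univ : Finset (Fin n)).finsuppAntidiag d,
        MvPolynomial.C (MvPowerSeries.coeff e F) *
          ∏ i, (MvPolynomial.C (c i) + MvPolynomial.X i) ^ (e i)) =
      ∑ e ∈ (Finset.univ : Finset (Fin n)).finsuppAntidiag d,
        MvPowerSeries.coeff e F * ∏ i, (((e i).choose (β i) : k) * c i ^ (e i - β i)) := by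
  rw [MvPolynomial.coeff_sum]
  refine Finset.sum_congr rfl fun e _ => ?_
  rw [MvPolynomial.coeff_C_mul, CobordantChart.coeff_prod_C_add_X_pow]

/-- Evaluating the initial form: `in_d F (v) = initEval 1 v d F`. -/
theorem eval_initForm (v : Fin n → k) (d : ℕ) (F : MvPowerSeries (Fin n) k) :
    MvPolynomial.eval v (∑ e ∈ (Finset.univ : Finset (Fin n)).finsuppAntidiag d,
        MvPolynomial.monomial e (MvPowerSeries.coeff e F)) =
      CobordantChart.initEval (fun _ : Fin n => 1) v d F := by
  rw [map_sum, initEval_one_eq_sum]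
  refine Finset.sum_congr rfl fun e _ => ?_
  rw [MvPolynomial.eval_monomial, Finsupp.prod_pow]

/-- Evaluating the translate: `in_d F (c + v) = initEval 1 (v + c) d F`. -/
theorem eval_translate (c v : Fin n → k) (d : ℕ) (F : MvPowerSeries (Fin n) k) :
    MvPolynomial.eval v (∑ e ∈ (Finset.univ : Finset (Fin n)).finsuppAntidiag d,
        MvPolynomial.C (MvPowerSeries.coeff e F) *
          ∏ i, (MvPolynomial.C (c i) + MvPolynomial.X i) ^ (e i)) =
      CobordantChart.initEval (fun _ : Fin n => 1) (v + c) d F := by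
  rw [map_sum, initEval_one_eq_sum]
  refine Finset.sum_congr rfl fun e _ => ?_
  rw [map_mul, MvPolynomial.eval_C, map_prod]
  congr 1
  refine Finset.prod_congr rfl fun i _ => ?_
  rw [map_pow, map_add, MvPolynomial.eval_C, MvPolynomial.eval_X, Pi.add_apply, add_comm]

/-- THE TOP-DEGREE PART OF A TRANSLATED FORM IS THE FORM: if `F(s(c+y)) = s^d · G` and the
`s⁰`-slice `G(0,·)` has order `≥ d`, then `in_d F (c + y) = in_d F (y)` as polynomials. -/
theorem translate_eq_initForm {F : MvPowerSeries (Fin n) k} {c : Fin n → k} {d : ℕ}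
    {G : MvPowerSeries (Fin (n + 1)) k}
    (hfac : MvPowerSeries.subst (CobordantChart.chart (fun _ : Fin n => 1) c) F =
      MvPowerSeries.X 0 ^ d * G)
    (hGd : (d : ℕ∞) ≤ MvPowerSeries.order
      (show MvPowerSeries (Fin n) k from fun β => MvPowerSeries.coeff (Finsupp.cons 0 β) G)) :
    (∑ e ∈ (Finset.univ : Finset (Fin n)).finsuppAntidiag d,
        MvPolynomial.C (MvPowerSeries.coeff e F) *
          ∏ i, (MvPolynomial.C (c i) + MvPolynomial.X i) ^ (e i)) =
      ∑ e ∈ (Finset.univ : Finset (Fin n)).finsuppAntidiag d,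
        MvPolynomial.monomial e (MvPowerSeries.coeff e F) := by
  refine MvPolynomial.ext _ _ fun β => ?_
  rw [coeff_translate, coeff_initForm]
  by_cases hβ : β.degree < d
  · -- low degree: the Taylor coefficient is a slice coefficient, which vanishes
    have h0 : MvPowerSeries.coeff (Finsupp.cons 0 β) G = 0 := by
      change MvPowerSeries.coeff β
        (show MvPowerSeries (Fin n) k from fun β => MvPowerSeries.coeff (Finsupp.cons 0 β) G) = 0
      exact MvPowerSeries.coeff_of_lt_order (lt_of_lt_of_le (by exact_mod_cast hβ) hGd)
    rw [coeff_cons_zero_eq_sum hfac β] at h0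
    rw [h0, if_neg]
    intro hmem
    rw [mem_antidiag_iff, weight_one_eq_degree] at hmem
    omega
  · -- degree `≥ d`: the top-degree part of the translate is the form
    push Not at hβ
    rw [sum_translate_eq_of_le F c hβ]
    by_cases hw : Finsupp.weight (fun _ : Fin n => 1) β = d
    · rw [if_pos hw, if_pos ((mem_antidiag_iff d β).mpr hw)]
    · rw [if_neg hw, if_neg (fun h => hw ((mem_antidiag_iff d β).mp h))]

end ApexFreeOrderDrop

open ApexFreeOrderDrop in
/-- APEX-FREE ORDER DROP, stub `stub_apexFreeOrderDrop` of the line `hasse-ridge-face-selection` of crux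
`LocalWeightedDrop` (stmt-ResolutionOfSingularities-8899): under ONE point blow-up (all weights `1`) of a
germ `F` of order `d`, if at the exceptional point `c` (factorisation `F(s(c+y)) = sᵃ·G`, `s ∤ G`) the
tame slice `G|_{yᵢ = 0}` (`cᵢ ≠ 0`) still has order `≥ d`, then `c` is in the apex of the tangent cone:
`in_d F (v + c) = in_d F (v)` for all `v`.  Char-free; `p` is only used to invoke `tameSlice`. -/
theorem stub_apexFreeOrderDrop : ∀ (p : ℕ), p.Prime → ∀ (k : Type) [Field k] [CharP k p] (n : ℕ)
    (F : MvPowerSeries (Fin n) k) (d : ℕ), F.order = d →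
    ∀ (c : Fin n → k) (a : ℕ) (G : MvPowerSeries (Fin (n + 1)) k),
    MvPowerSeries.subst (CobordantChart.chart (fun _ : Fin n => 1) c) F = MvPowerSeries.X 0 ^ a * G →
    ¬ (MvPowerSeries.X (0 : Fin (n + 1)) ∣ G) →
    ∀ i : Fin n, c i ≠ 0 →
    (d : ℕ∞) ≤ MvPowerSeries.order (MvPowerSeries.subst
      (fun j : Fin (n + 1) => if j = i.succ then (0 : MvPowerSeries (Fin n) k)
        else MvPowerSeries.X (Fin.predAbove i j)) G) →
    ∀ v : Fin n → k, CobordantChart.initEval (fun _ : Fin n => 1) (v + c) d F =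
      CobordantChart.initEval (fun _ : Fin n => 1) v d F := by
  intro p hp k _ _ n F d hFd c a G hfac hndvd i hci hS v
  -- all weights are `1 ≠ 0`: the chart convention holds vacuously
  have hc : ∀ i, (fun _ : Fin n => 1) i = 0 → c i = 0 := fun i hi => absurd hi one_ne_zero
  have hF : F ≠ 0 := by
    rintro rfl
    rw [MvPowerSeries.order_zero] at hFd
    exact ENat.top_ne_coe d hFd
  -- `a = d` (the order is the weighted order for the weights `1`)
  have had : a = d := by
    have h : (a : ℕ∞) = F.weightedOrder (fun _ : Fin n => 1) :=
      CobordantChart.eq_weightedOrder_of_factor _ c hc hF hfac hndvd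
    change (a : ℕ∞) = F.order at h
    rw [hFd] at h
    exact_mod_cast h
  rw [had] at hfac
  -- (1) `ord G ≥ ord S ≥ d` by the tame slice `G = u · Φ(cyl S)`
  have hp1 : ¬ p ∣ (fun _ : Fin n => 1) i := fun h => hp.one_lt.ne' (Nat.dvd_one.mp h)
  obtain ⟨Φ, u, hΦ0, -, -, hGu⟩ := tameSlice p hp k n F (fun _ => 1) c hc d G hfac i hci hp1
  have hGord : (d : ℕ∞) ≤ G.order := by
    rw [hGu]
    refine le_trans ?_ MvPowerSeries.le_order_mul
    refine le_trans ?_ le_add_self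
    refine le_trans ?_ (order_le_order_subst hΦ0 _)
    exact le_trans hS (order_le_order_subst (fun m => MvPowerSeries.constantCoeff_X _) _)
  -- (2) `ord G(0,·) ≥ ord G ≥ d`
  have hslice : (d : ℕ∞) ≤ MvPowerSeries.order
      (show MvPowerSeries (Fin n) k from fun β => MvPowerSeries.coeff (Finsupp.cons 0 β) G) :=
    hGord.trans (stub_sliceOrder k n G).1
  -- (3)–(5) `in_d F (v + c) = (in_d F (c + y))(v) = (in_d F)(v)`
  rw [← eval_translate c v d F, translate_eq_initForm hfac hslice, eval_initForm]

end Summit.ResolutionOfSingularities.ResolutionOfSingularities.Theorems
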